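import Summits.CriticalPhenomena.PercolationContinuityZ3.Theorems.Transplant.FKDoubleFanNegCorr
import Summits.CriticalPhenomena.PercolationContinuityZ3.Theorems.Transplant.FKDoubleFanSpokesAdjacent
import HarnessLib

/-!
# Double fans `K₂ ∨ P_{m+1}`: negative correlation of same-apex spokes at ADJACENT rim vertices, and of the axis with the spokes of `c 0`

Support file (`--supports stmt-CriticalPhenomena-4575`), FK sub-lane `prim-bschramm-fk-3` (gen 20); builds on p205010 (kernel theorem, internal
audit signed; external expert review pending).  No named facts, no sorries; standard axioms.  Memo `bschramm/prim-bschramm-fk-3/DOUBLE-FAN.md` §4, §8.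
Layer 4 of the double-fan bridge: the cut formula of `…DoubleFanNegCorr` at block `j+1` writes the four partition functions with the spokes
`a c_j`, `a c_{j+1}` pinned as the `spokesAZ` valuations of `…DoubleFanSpokesAdjacent` with `u = edgeBC(w_{b c_j}) · (input of block j)` and
`s = (reversed suffix) · edgeBC(w_{b c_{j+1}})`, both in `InKE q`; the exact positive formula of that file then gives
**`negCorr_spokesA_adjacent`** (the `b`-version is the relabelling `a ↔ b`, not spelled out): for `0 < q ≤ 1`, every weight vector on
the double fan and every `j < m`, `φ(J_{a c_j} ∩ J_{a c_{j+1}}) ≤ φ(J_{a c_j}) φ(J_{a c_{j+1}})`.  Also **`negCorr_axis_spokeA_zero`**: the axis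
`ab` and the spoke `a c_0` (a same-block pair, master form `N^{(bc)}`).
[cite: Grimmett2006, §3.9 eq. (3.94) (pp. 63–64); §1.4 eq. (1.20) (p. 15)] [folklore]
-/

noncomputable section

namespace Summit.CriticalPhenomena.PercolationContinuityZ3.Theorems

namespace FK

namespace ThreeApex

open MeasureTheory Literature.Probability.LatticeModels Literature.Probability.Percolation
open scoped Classical

/-- **Same-block Rayleigh identity for the axis and an `a`-spoke**: `Z¹⁰Z⁰¹ − Z¹¹Z⁰⁰ = q²(1−q)·N^{(bc)}(R)` (first index: the spoke `a c`,
second: the axis `ab`). [folklore] -/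
theorem rayleigh_AC_AB_eq (q : ℝ) (R : V5) :
    val q (conv (edgeAC 1) (conv (edgeAB 0) R)) * val q (conv (edgeAC 0) (conv (edgeAB 1) R)) -
        val q (conv (edgeAC 1) (conv (edgeAB 1) R)) * val q (conv (edgeAC 0) (conv (edgeAB 0) R)) =
      q ^ 2 * (1 - q) * masterN q (swapAB R) := by
  simp only [val, conv, edgeAC, edgeAB, masterN, swapAB, V5.total]; ring

variable {V : Type*} [Fintype V]

section Setting

variable {a b : V} {c : ℕ → V} {m : ℕ}
variable (hab : a ≠ b) (hinj : ∀ j k, j ≤ m → k ≤ m → c j = c k → j = k) (hca : ∀ j, j ≤ m → c j ≠ a) (hcb : ∀ j, j ≤ m → c j ≠ b)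
include hab hinj hca hcb

omit [Fintype V] hab hinj hca hcb in
/-- Re-pinning a double-fan pair keeps the support inside the double fan. [folklore] -/
theorem supp_update_dfPair (w : Sym2 V → unitInterval) (hsupp : ∀ e, e ∉ dfPairs a b c m → w e = 0) {e : Sym2 V}
    (he : e ∈ dfPairs a b c m) (σ : unitInterval) : ∀ g, g ∉ dfPairs a b c m → Function.update w e σ g = 0 := by
  intro g hg
  have hne : g ≠ e := fun h => hg (h ▸ he)
  rw [Function.update_of_ne hne]
  exact hsupp g hg

/-! ### Two `a`-spokes at adjacent rim vertices -/

omit [Fintype V] hab hinj hca hcb in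
/-- The input of block `j+1` is the rim step applied to `Z_j`. [folklore] -/
theorem blockIn_succ (q : ℝ) (w : Sym2 V → unitInterval) (j : ℕ) :
    blockIn q w a b c (j + 1) = rimStep q (wR w s(c j, c (j + 1))) (zDF q w a b c j) := rfl

omit [Fintype V] in
/-- **The word with the `a`-spokes of `c j` and `c (j+1)` pinned**, through the cut at block `j+1`: the four partition functions are the
`spokesAZ` valuations with `u = edgeBC(w_{b c_j}) · (input of block j)` and `s = (reversed suffix) · edgeBC(w_{b c_{j+1}})`. [folklore] -/
theorem cut_pin_spokesA_adjacent (q : ℝ) (w : Sym2 V → unitInterval) {j : ℕ} (hj : j + 1 ≤ m) (σ τ : unitInterval) :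
    transferDF q (Function.update (Function.update w s(a, c j) σ) s(a, c (j + 1)) τ) a b c m =
      spokesAZ q (wR w s(c j, c (j + 1))) (conv (edgeBC (wR w s(b, c j))) (blockIn q w a b c j))
        (conv (restVec q w a b c (j + 1) (m - (j + 1))) (edgeBC (wR w s(b, c (j + 1))))) (σ : ℝ) (τ : ℝ) := by
  set w₁ := Function.update w s(a, c j) σ with hw₁
  set w₂ := Function.update w₁ s(a, c (j + 1)) τ with hw₂
  have hj0 : j ≤ m := by omega
  have hlater1 : ∀ k, j + 1 < k → k ≤ m → ¬ ReadsAt a b c k s(a, c j) := fun k hk hkm hr =>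
    absurd ((readsAt_spokeA_iff hab hinj hca hcb hj0 hkm).1 hr) (by omega)
  have hlater2 : ∀ k, j + 1 < k → k ≤ m → ¬ ReadsAt a b c k s(a, c (j + 1)) := fun k hk hkm hr =>
    absurd ((readsAt_spokeA_iff hab hinj hca hcb hj hkm).1 hr) (by omega)
  have hrest : restVec q w₂ a b c (j + 1) (m - (j + 1)) = restVec q w a b c (j + 1) (m - (j + 1)) := by
    rw [hw₂, restVec_update_eq q w₁ τ (m - (j + 1)) (j + 1) (by omega) hlater2, hw₁,
      restVec_update_eq q w σ (m - (j + 1)) (j + 1) (by omega) hlater1]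
  have hin : blockIn q w₂ a b c j = blockIn q w a b c j := by
    rw [hw₂, blockIn_update_eq q w₁ τ (fun k hk hr => absurd ((readsAt_spokeA_iff hab hinj hca hcb hj (by omega)).1 hr) (by omega))
      (spokeA_ne_axis hab hcb hj) (fun i hi => spokeA_ne_rim hca (j := j + 1) (by omega)),
      hw₁, blockIn_update_eq q w σ (fun k hk hr => absurd ((readsAt_spokeA_iff hab hinj hca hcb hj0 (by omega)).1 hr) (by omega))
      (spokeA_ne_axis hab hcb hj0) (fun i hi => hi ▸ spokeA_ne_rim hca (j := i + 1) (hi ▸ hj0))]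
  have hσ : wR w₂ s(a, c j) = (σ : ℝ) := by
    rw [hw₂, wR_update_of_ne w₁ (spokeA_ne_spokeA hinj hj0 hj (by omega)), hw₁, wR_update_self]
  have hτ : wR w₂ s(a, c (j + 1)) = (τ : ℝ) := by rw [hw₂, wR_update_self]
  have hy0 : wR w₂ s(b, c j) = wR w s(b, c j) := by
    rw [hw₂, wR_update_of_ne w₁ (spokeA_ne_spokeB hab hca hj0).symm, hw₁, wR_update_of_ne w (spokeA_ne_spokeB hab hca hj0).symm]
  have hy1 : wR w₂ s(b, c (j + 1)) = wR w s(b, c (j + 1)) := by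
    rw [hw₂, wR_update_of_ne w₁ (spokeA_ne_spokeB hab hca hj).symm, hw₁, wR_update_of_ne w (spokeA_ne_spokeB hab hca hj).symm]
  have hr : wR w₂ s(c j, c (j + 1)) = wR w s(c j, c (j + 1)) := by
    rw [hw₂, wR_update_of_ne w₁ (spokeA_ne_rim hca (j := j + 1) hj).symm, hw₁, wR_update_of_ne w (spokeA_ne_rim hca (j := j) hj).symm]
  rw [transferDF_eq_cut q w₂ a b c hj, zDF_eq_block, hrest, blockIn_succ, zDF_eq_block q w₂ a b c j, hin, hσ, hτ, hy0, hy1, hr]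
  -- reassociate: s ∗ (AC τ ∗ (BC y' ∗ W)) = (s ∗ BC y') ∗ (AC τ ∗ W)
  simp only [spokesAZ, ← mul_def]
  rw [mul_left_comm (edgeAC (τ : ℝ)) (edgeBC _), ← mul_assoc (restVec q w a b c (j + 1) (m - (j + 1)))]

/-- **NEGATIVE CORRELATION OF TWO `a`-SPOKES AT ADJACENT RIM VERTICES** of a double fan (`0 < q ≤ 1`, `card V = m + 3`, `w` supported on the
double fan, `j + 1 ≤ m`): `φ(J_{a c_j} ∩ J_{a c_{j+1}}) ≤ φ(J_{a c_j})·φ(J_{a c_{j+1}})`. [cite: Grimmett2006, §3.9 eq. (3.94) (pp. 63–64)] -/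
theorem negCorr_spokesA_adjacent (hcard : Fintype.card V = m + 3) {q : ℝ} (hq0 : 0 < q) (hq1 : q ≤ 1) (w : Sym2 V → unitInterval)
    (hsupp : ∀ e, e ∉ dfPairs a b c m → w e = 0) {j : ℕ} (hj : j + 1 ≤ m) :
    (rcMeasureW w q ∅).real ({ω : BondConfig V | s(a, c j) ∈ ω} ∩ {ω | s(a, c (j + 1)) ∈ ω}) ≤
      (rcMeasureW w q ∅).real {ω : BondConfig V | s(a, c j) ∈ ω} * (rcMeasureW w q ∅).real {ω : BondConfig V | s(a, c (j + 1)) ∈ ω} := by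
  have hj0 : j ≤ m := by omega
  have he : s(a, c j) ∈ dfPairs a b c m := (mem_dfPairs_iff a b c m _).2 (Or.inr (Or.inl ⟨j, hj0, Or.inl rfl⟩))
  have hf : s(a, c (j + 1)) ∈ dfPairs a b c m := (mem_dfPairs_iff a b c m _).2 (Or.inr (Or.inl ⟨j + 1, hj, Or.inl rfl⟩))
  have hne : s(a, c (j + 1)) ≠ s(a, c j) := spokeA_ne_spokeA hinj hj hj0 (by omega)
  set u := conv (edgeBC (wR w s(b, c j))) (blockIn q w a b c j) with hu
  set s := conv (restVec q w a b c (j + 1) (m - (j + 1))) (edgeBC (wR w s(b, c (j + 1)))) with hs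
  have hZ : ∀ σ τ : unitInterval, rcPartitionFunctionW (Function.update (Function.update w s(a, c j) σ) s(a, c (j + 1)) τ) q ∅ =
      spokesAZ q (wR w s(c j, c (j + 1))) u s (σ : ℝ) (τ : ℝ) := by
    intro σ τ
    rw [rcPartitionFunctionW_eq_transferDF hab hinj hca hcb hcard q _
      (supp_update_dfPair _ (supp_update_dfPair w hsupp he σ) hf τ),
      cut_pin_spokesA_adjacent hab hinj hca hcb q w hj σ τ]
  have huK : InKE q u := InKE.step (IsLetter.bc (w _).2.1 (w _).2.2) (inKE_blockIn q w a b c j)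
  have hsK : InKE q s := InKE.mul (inKE_restVec q w a b c (m - (j + 1)) (j + 1)) (by
    rw [← mul_one (edgeBC (wR w s(b, c (j + 1)))), mul_def, one_def]
    exact InKE.step (IsLetter.bc (w _).2.1 (w _).2.2) InKE.base)
  have key := InKE.rayleigh_spokesA_adjacent_nonneg (r := wR w s(c j, c (j + 1))) hq0.le hq1 (w s(c j, c (j + 1))).2.1
    (w s(c j, c (j + 1))).2.2 huK hsK
  refine negCorr_of_pinned_rayleigh w hq0 hne ?_
  rw [hZ 1 1, hZ 0 0, hZ 1 0, hZ 0 1]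
  simp only [Set.Icc.coe_one, Set.Icc.coe_zero]
  linarith [key]

/-! ### The axis and the `a`-spoke of `c 0` -/

omit [Fintype V] in
/-- The word with the axis and the spoke `a c_0` pinned, through the cut at block `0`. [folklore] -/
theorem cut_pin_axis_spokeA (q : ℝ) (w : Sym2 V → unitInterval) (σ τ : unitInterval) :
    transferDF q (Function.update (Function.update w s(a, c 0) σ) s(a, b) τ) a b c m =
      val q (conv (edgeAC (σ : ℝ)) (conv (edgeAB (τ : ℝ)) (conv (restVec q w a b c 0 m) (edgeBC (wR w s(b, c 0)))))) := by
  set w₁ := Function.update w s(a, c 0) σ with hw₁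
  set w₂ := Function.update w₁ s(a, b) τ with hw₂
  have h0 : 0 ≤ m := Nat.zero_le _
  have hlater1 : ∀ k, 0 < k → k ≤ m → ¬ ReadsAt a b c k s(a, c 0) := fun k hk hkm hr =>
    absurd ((readsAt_spokeA_iff hab hinj hca hcb h0 hkm).1 hr) (by omega)
  have hlater2 : ∀ k, 0 < k → k ≤ m → ¬ ReadsAt a b c k s(a, b) := fun k hk hkm hr =>
    absurd ((readsAt_axis_iff hab hca hcb hkm).1 hr) (by omega)
  have hrest : restVec q w₂ a b c 0 m = restVec q w a b c 0 m := by
    rw [hw₂, restVec_update_eq q w₁ τ m 0 (by omega) hlater2, hw₁, restVec_update_eq q w σ m 0 (by omega) hlater1]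
  have hσ : wR w₂ s(a, c 0) = (σ : ℝ) := by
    rw [hw₂, wR_update_of_ne w₁ (spokeA_ne_axis hab hcb h0), hw₁, wR_update_self]
  have hτ : wR w₂ s(a, b) = (τ : ℝ) := by rw [hw₂, wR_update_self]
  have hy : wR w₂ s(b, c 0) = wR w s(b, c 0) := by
    rw [hw₂, wR_update_of_ne w₁ (spokeB_ne_axis hab hca h0), hw₁, wR_update_of_ne w (spokeA_ne_spokeB hab hca h0).symm]
  rw [transferDF_eq_cut q w₂ a b c (Nat.zero_le m), Nat.sub_zero, zDF_eq_block, hrest]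
  simp only [blockIn, hσ, hτ, hy]
  simp only [← mul_def, ← one_def, mul_one]
  -- s ∗ (AC σ ∗ (BC y ∗ AB τ)) = AC σ ∗ (AB τ ∗ (s ∗ BC y))
  rw [mul_left_comm (restVec q w a b c 0 m), mul_comm (edgeBC _) (edgeAB _), mul_left_comm (restVec q w a b c 0 m)]

/-- **The axis and the spoke `a c_0` are negatively correlated** in every weighted double fan (`0 < q ≤ 1`). [cite: Grimmett2006, §3.9 eq. (3.94) (pp. 63–64)] -/
theorem negCorr_axis_spokeA_zero (hcard : Fintype.card V = m + 3) {q : ℝ} (hq0 : 0 < q) (hq1 : q ≤ 1) (w : Sym2 V → unitInterval)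
    (hsupp : ∀ e, e ∉ dfPairs a b c m → w e = 0) :
    (rcMeasureW w q ∅).real ({ω : BondConfig V | s(a, c 0) ∈ ω} ∩ {ω | s(a, b) ∈ ω}) ≤
      (rcMeasureW w q ∅).real {ω : BondConfig V | s(a, c 0) ∈ ω} * (rcMeasureW w q ∅).real {ω : BondConfig V | s(a, b) ∈ ω} := by
  have he : s(a, c 0) ∈ dfPairs a b c m := (mem_dfPairs_iff a b c m _).2 (Or.inr (Or.inl ⟨0, Nat.zero_le _, Or.inl rfl⟩))
  have hf : s(a, b) ∈ dfPairs a b c m := (mem_dfPairs_iff a b c m _).2 (Or.inl rfl)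
  have hne : s(a, b) ≠ s(a, c 0) := (spokeA_ne_axis hab hcb (Nat.zero_le _)).symm
  set R := conv (restVec q w a b c 0 m) (edgeBC (wR w s(b, c 0))) with hR
  have hZ : ∀ σ τ : unitInterval, rcPartitionFunctionW (Function.update (Function.update w s(a, c 0) σ) s(a, b) τ) q ∅ =
      val q (conv (edgeAC (σ : ℝ)) (conv (edgeAB (τ : ℝ)) R)) := by
    intro σ τ
    rw [rcPartitionFunctionW_eq_transferDF hab hinj hca hcb hcard q _
      (supp_update_dfPair _ (supp_update_dfPair w hsupp he σ) hf τ),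
      cut_pin_axis_spokeA hab hinj hca hcb q w σ τ]
  have hRK : InKE q R := InKE.mul (inKE_restVec q w a b c m 0) (by
    rw [← mul_one (edgeBC (wR w s(b, c 0))), mul_def, one_def]
    exact InKE.step (IsLetter.bc (w _).2.1 (w _).2.2) InKE.base)
  have hN : 0 ≤ masterN q (swapAB R) := (hRK.valid hq0.le hq1).nBC
  refine negCorr_of_pinned_rayleigh w hq0 hne ?_
  rw [hZ 1 1, hZ 0 0, hZ 1 0, hZ 0 1]
  simp only [Set.Icc.coe_one, Set.Icc.coe_zero]
  have hid := rayleigh_AC_AB_eq q R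
  have hq' : 0 ≤ 1 - q := sub_nonneg.2 hq1
  nlinarith [hid, hN, mul_nonneg (mul_nonneg (pow_nonneg hq0.le 2) hq') hN]

/-! ### The `b`-versions: swap the roles of the two apices -/

omit [Fintype V] hab hinj hca hcb in
/-- The double-fan pairs do not depend on the order of the two apices. [folklore] -/
theorem dfPairs_swap : dfPairs b a c m = dfPairs a b c m := by
  ext e
  simp only [mem_dfPairs_iff, Sym2.eq_swap (a := b) (b := a)]
  constructor
  · rintro (h | ⟨j, hj, h | h⟩ | h)
    · exact Or.inl h
    · exact Or.inr (Or.inl ⟨j, hj, Or.inr h⟩)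
    · exact Or.inr (Or.inl ⟨j, hj, Or.inl h⟩)
    · exact Or.inr (Or.inr h)
  · rintro (h | ⟨j, hj, h | h⟩ | h)
    · exact Or.inl h
    · exact Or.inr (Or.inl ⟨j, hj, Or.inr h⟩)
    · exact Or.inr (Or.inl ⟨j, hj, Or.inl h⟩)
    · exact Or.inr (Or.inr h)

/-- **Two `b`-spokes at adjacent rim vertices are negatively correlated** (the `a ↔ b` relabelling of `negCorr_spokesA_adjacent`). [cite: Grimmett2006, §3.9 eq. (3.94) (pp. 63–64)] -/
theorem negCorr_spokesB_adjacent (hcard : Fintype.card V = m + 3) {q : ℝ} (hq0 : 0 < q) (hq1 : q ≤ 1) (w : Sym2 V → unitInterval)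
    (hsupp : ∀ e, e ∉ dfPairs a b c m → w e = 0) {j : ℕ} (hj : j + 1 ≤ m) :
    (rcMeasureW w q ∅).real ({ω : BondConfig V | s(b, c j) ∈ ω} ∩ {ω | s(b, c (j + 1)) ∈ ω}) ≤
      (rcMeasureW w q ∅).real {ω : BondConfig V | s(b, c j) ∈ ω} * (rcMeasureW w q ∅).real {ω : BondConfig V | s(b, c (j + 1)) ∈ ω} :=
  negCorr_spokesA_adjacent hab.symm hinj hcb hca hcard hq0 hq1 w (fun e he => hsupp e (by rwa [dfPairs_swap] at he)) hj

/-- **The axis and the spoke `b c_0` are negatively correlated** (the `a ↔ b` relabelling of `negCorr_axis_spokeA_zero`). [cite: Grimmett2006, §3.9 eq. (3.94) (pp. 63–64)] -/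
theorem negCorr_axis_spokeB_zero (hcard : Fintype.card V = m + 3) {q : ℝ} (hq0 : 0 < q) (hq1 : q ≤ 1) (w : Sym2 V → unitInterval)
    (hsupp : ∀ e, e ∉ dfPairs a b c m → w e = 0) :
    (rcMeasureW w q ∅).real ({ω : BondConfig V | s(b, c 0) ∈ ω} ∩ {ω | s(a, b) ∈ ω}) ≤
      (rcMeasureW w q ∅).real {ω : BondConfig V | s(b, c 0) ∈ ω} * (rcMeasureW w q ∅).real {ω : BondConfig V | s(a, b) ∈ ω} := by
  have h := negCorr_axis_spokeA_zero hab.symm hinj hcb hca hcard hq0 hq1 w (fun e he => hsupp e (by rwa [dfPairs_swap] at he))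
  rwa [Sym2.eq_swap (a := b) (b := a)] at h

end Setting

end ThreeApex

end FK

end Summit.CriticalPhenomena.PercolationContinuityZ3.Theorems
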